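import Summits.Schanuel.Schanuel.Theorems.ZilberEacParamCurveDirections
import HarnessLib

/-!
# Polynomially parametrised base curves, II: exact roots ON the ray and the growth of a second
# polynomial near the ray

HONEST FRAMING.  Cell `pub-schanuel` (Zilber's Exponential-Algebraic Closedness, case ladder;
host summit Schanuel), seat 2, gen 19.  Second file of the series on product surfaces over a
polynomially parametrised base curve `C = {(g₀(t), g₁(t))}` (Mantova–Masser's OPEN density
question, PLMS 2024 §1 p. 5, for these surfaces).  NOT Schanuel's conjecture (neither used nor
implied; EAC ⇏ SC); `EC(3,2)` stays OPEN.

* `exists_alRoot_dir` — seat 1's stage-`k` root `z₀ = (k+1) ω e^{ζ/d}` of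
  `r(z₀) = (k+1)^d s · 2πi + c₀` (`lc(r) ω^d = 2πi s`, `EACDensityAligned.exists_alRoot`), with the
  DIRECTION now controlled: `‖ζ‖ ≤ C₁/(π (k+1))` (a posteriori from
  `e^{ζ} - 1 = (c₀ - ℓ(z₀))/T`, `‖T‖ = 2π (k+1)^d`, `‖c₀ - ℓ(z₀)‖ ≤ C₁ (k+1)^{d-1}`), and no
  hypothesis on `Re ω`.
* `re_eval_near_ray_le` / `norm_eval_near_ray_le` — for a polynomial `G` of degree `m ≥ 1` with
  leading coefficient `b`: on the unit disc around such a root,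
  `Re G(z) ≤ Re(b ω^m) (k+1)^m + K₂ (k+1)^{m-1}` and `‖G(z)‖ ≤ K₃ (k+1)^m` with explicit
  constants; with `Re(b ω^m) < 0` (file I) the coordinate `G = g₀` degenerates polynomially along
  the escape, which is what the engine of file III and THEOREM G need.
-/

noncomputable section

open Complex Polynomial
open Literature.ModelTheory.Zilber
open Literature.Geometry.Symplectic.RotationBranch (norm_pow_sub_pow_le)

set_option linter.dupNamespace false

namespace Summit.Schanuel.Schanuel.Theorems

/-! ## Part A. Exact roots on the ray with direction control -/

/-- The lower-order part on the local ray: for `‖ζ‖ < 1`,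
`‖ℓ((k+1)ω e^{ζ/d}) - c₀‖ ≤ (Σ‖ℓᵢ‖ (3‖ω‖+1)^{d-1} + ‖c₀‖) (k+1)^{d-1}` (`ℓ = r.eraseLead`,
`d = deg r ≥ 1`). -/
theorem norm_eraseLead_eval_ray_sub_le (r : Polynomial ℂ) (hd1 : 1 ≤ r.natDegree) (ω c₀ : ℂ)
    (k : ℕ) {ζ : ℂ} (hζ : ‖ζ‖ < 1) :
    ‖r.eraseLead.eval (((k : ℂ) + 1) * ω * exp (ζ / r.natDegree)) - c₀‖ ≤
      (coeffNormSum r.eraseLead * (3 * ‖ω‖ + 1) ^ (r.natDegree - 1) + ‖c₀‖) *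
        ((k : ℝ) + 1) ^ (r.natDegree - 1) := by
  set d : ℕ := r.natDegree with hd_def
  set ℓ : Polynomial ℂ := r.eraseLead with hℓ_def
  have hx : ‖ζ / (d : ℂ)‖ ≤ 1 := by
    rw [norm_div, Complex.norm_natCast]
    exact (div_le_self (norm_nonneg _) (by exact_mod_cast hd1)).trans hζ.le
  set M : ℝ := ((k : ℝ) + 1) * (3 * ‖ω‖ + 1) with hM
  have hk0 : (0 : ℝ) ≤ (k : ℝ) := Nat.cast_nonneg k
  have hM1 : 1 ≤ M := by
    have h1 : (1 : ℝ) ≤ (k : ℝ) + 1 := by linarith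
    have h2 : (1 : ℝ) ≤ 3 * ‖ω‖ + 1 := by linarith [norm_nonneg ω]
    nlinarith
  have hzM : ‖((k : ℂ) + 1) * ω * exp (ζ / d)‖ ≤ M := by
    rw [norm_mul, norm_mul, norm_natCast_add_one, hM]
    have := norm_exp_le_three hx
    calc ((k : ℝ) + 1) * ‖ω‖ * ‖exp (ζ / d)‖ ≤ ((k : ℝ) + 1) * ‖ω‖ * 3 :=
          mul_le_mul_of_nonneg_left this (by positivity)
      _ ≤ ((k : ℝ) + 1) * (3 * ‖ω‖ + 1) := by nlinarith [norm_nonneg ω]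
  have hℓdeg : ℓ.natDegree ≤ d - 1 := Polynomial.eraseLead_natDegree_le r
  have h1 : ‖ℓ.eval (((k : ℂ) + 1) * ω * exp (ζ / d))‖ ≤ coeffNormSum ℓ * M ^ (d - 1) :=
    norm_eval_le_of_natDegree_le ℓ hM1 hzM hℓdeg
  have hkpow : (1 : ℝ) ≤ ((k : ℝ) + 1) ^ (d - 1) := one_le_pow₀ (by linarith)
  calc ‖ℓ.eval (((k : ℂ) + 1) * ω * exp (ζ / d)) - c₀‖
      ≤ ‖ℓ.eval (((k : ℂ) + 1) * ω * exp (ζ / d))‖ + ‖c₀‖ := norm_sub_le _ _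
    _ ≤ coeffNormSum ℓ * M ^ (d - 1) + ‖c₀‖ * ((k : ℝ) + 1) ^ (d - 1) := by
        refine add_le_add h1 ?_
        exact le_mul_of_one_le_right (norm_nonneg _) hkpow
    _ = (coeffNormSum ℓ * (3 * ‖ω‖ + 1) ^ (d - 1) + ‖c₀‖) * ((k : ℝ) + 1) ^ (d - 1) := by
        rw [hM, mul_pow]; ring

/-- **Stage `k`: an exact root ON the ray.**  `deg r = d ≥ 2`, `lc(r) ω^d = 2πi s` (`s = ±1`),
`32 C₁ ≤ 2π(k+1)` with `C₁ = Σ‖ℓᵢ‖ (3‖ω‖+1)^{d-1} + ‖c₀‖`.  Then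
`r((k+1) ω e^{ζ/d}) = (k+1)^d s · 2πi + c₀` for some `ζ` with `‖ζ‖ ≤ 1/2` AND
`‖ζ‖ ≤ C₁ / (π (k+1))` — the root lies within angle `O(1/k)` of the ray `ℝ₊ ω`.  (No hypothesis on
`Re ω`; compare `EACDensityAligned.exists_alRoot`.) (new) -/
theorem exists_alRoot_dir (r : Polynomial ℂ) (hd : 2 ≤ r.natDegree) (ω : ℂ) (s : ℤ)
    (hs : s = 1 ∨ s = -1) (hω : r.leadingCoeff * ω ^ r.natDegree = 2 * Real.pi * I * s)
    (c₀ : ℂ) (k : ℕ)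
    (hk : 32 * (coeffNormSum r.eraseLead * (3 * ‖ω‖ + 1) ^ (r.natDegree - 1) + ‖c₀‖) ≤
      2 * Real.pi * ((k : ℝ) + 1)) :
    ∃ ζ : ℂ, ‖ζ‖ ≤ 1 / 2 ∧
      ‖ζ‖ ≤ (coeffNormSum r.eraseLead * (3 * ‖ω‖ + 1) ^ (r.natDegree - 1) + ‖c₀‖) /
        (Real.pi * ((k : ℝ) + 1)) ∧
      r.eval (((k : ℂ) + 1) * ω * exp (ζ / r.natDegree)) =
        (((k + 1) ^ r.natDegree * s : ℤ) : ℂ) * (2 * Real.pi * I) + c₀ := by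
  set d : ℕ := r.natDegree with hd_def
  set a : ℂ := r.leadingCoeff with ha_def
  set ℓ : Polynomial ℂ := r.eraseLead with hℓ_def
  set C₁ : ℝ := coeffNormSum ℓ * (3 * ‖ω‖ + 1) ^ (d - 1) + ‖c₀‖ with hC₁
  have hd1 : 1 ≤ d := le_trans (by norm_num) hd
  have hk0 : (0 : ℝ) ≤ (k : ℝ) := Nat.cast_nonneg k
  have hkpos : (0 : ℝ) < (k : ℝ) + 1 := by linarith
  have hC₁0 : 0 ≤ C₁ := by have := coeffNormSum_nonneg ℓ; positivity
  set z₁ : ℂ := ((k : ℂ) + 1) * ω with hz₁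
  set T : ℂ := (((k + 1) ^ d * s : ℤ) : ℂ) * (2 * Real.pi * I) with hT_def
  have hT : a * z₁ ^ d = T := by
    have : a * z₁ ^ d = ((k : ℂ) + 1) ^ d * (a * ω ^ d) := by rw [hz₁, mul_pow]; ring
    rw [this, hω, hT_def]; push_cast; ring
  have hTnorm : ‖T‖ = 2 * Real.pi * ((k : ℝ) + 1) ^ d := by
    rw [← hT, norm_mul, norm_pow, hz₁, norm_mul, norm_natCast_add_one, mul_pow]
    have hsabs : |(s : ℝ)| = 1 := by rcases hs with rfl | rfl <;> simp
    have haω : ‖a‖ * ‖ω‖ ^ d = 2 * Real.pi := by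
      rw [← norm_pow, ← norm_mul, hω]
      simp [hsabs, Complex.norm_real, Real.norm_eq_abs, abs_of_pos Real.pi_pos]
    calc ‖a‖ * (((k : ℝ) + 1) ^ d * ‖ω‖ ^ d) = (‖a‖ * ‖ω‖ ^ d) * ((k : ℝ) + 1) ^ d := by ring
      _ = 2 * Real.pi * ((k : ℝ) + 1) ^ d := by rw [haω]
  have hTpos : 0 < ‖T‖ := by rw [hTnorm]; positivity
  have hT0 : T ≠ 0 := norm_pos_iff.mp hTpos
  have hpow : ((k : ℝ) + 1) ^ d = ((k : ℝ) + 1) * ((k : ℝ) + 1) ^ (d - 1) := by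
    rw [← pow_succ', Nat.sub_add_cancel hd1]
  -- smallness on the disc
  have hsmall : ∀ ζ : ℂ, ‖ζ‖ < 1 → ‖ℓ.eval (z₁ * exp (ζ / d)) - c₀‖ ≤ ‖T‖ / 32 := by
    intro ζ hζ
    have h2 := norm_eraseLead_eval_ray_sub_le r hd1 ω c₀ k hζ
    rw [← hd_def, ← hℓ_def, ← hC₁] at h2
    have h3 : C₁ * ((k : ℝ) + 1) ^ (d - 1) ≤ ‖T‖ / 32 := by
      rw [hTnorm, le_div_iff₀ (by norm_num : (0 : ℝ) < 32), hpow]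
      have h0 : (0 : ℝ) ≤ ((k : ℝ) + 1) ^ (d - 1) := by positivity
      nlinarith
    rw [hz₁]
    exact h2.trans h3
  obtain ⟨ζ, hζ, hroot⟩ := exists_polyRoot_mul_exp r (by omega) z₁ T c₀ hT hT0 hsmall
  refine ⟨ζ, hζ, ?_, by rw [← hd_def] at hroot; exact hroot⟩
  -- direction control: `T (e^ζ - 1) = c₀ - ℓ(z₀)`
  have hζ1 : ‖ζ‖ < 1 := by linarith
  have hdC : (d : ℂ) ≠ 0 := Nat.cast_ne_zero.mpr (by omega)
  have hlead : a * (z₁ * exp (ζ / d)) ^ d = T * exp ζ := by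
    rw [mul_pow, ← Complex.exp_nat_mul, mul_div_cancel₀ _ hdC, ← mul_assoc, hT]
  have hkey : T * (exp ζ - 1) = c₀ - ℓ.eval (z₁ * exp (ζ / d)) := by
    have h1 := eval_eq_eraseLead_add r (z₁ * exp (ζ / d))
    rw [hroot, ← hℓ_def, ← ha_def, ← hd_def, hlead] at h1
    linear_combination -h1
  have hexp1 : ‖exp ζ - 1‖ ≤ C₁ / (2 * Real.pi * ((k : ℝ) + 1)) := by
    have h1 : ‖T‖ * ‖exp ζ - 1‖ ≤ C₁ * ((k : ℝ) + 1) ^ (d - 1) := by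
      rw [← norm_mul, hkey, norm_sub_rev]
      have h2 := norm_eraseLead_eval_ray_sub_le r hd1 ω c₀ k hζ1
      rw [← hd_def, ← hℓ_def, ← hC₁, ← hz₁] at h2
      exact h2
    rw [hTnorm, hpow] at h1
    rw [le_div_iff₀ (by positivity)]
    have h0 : (0 : ℝ) < ((k : ℝ) + 1) ^ (d - 1) := by positivity
    nlinarith [norm_nonneg (exp ζ - 1)]
  have hζsq : ‖ζ‖ ≤ ‖exp ζ - 1‖ + ‖ζ‖ * (1 / 2) := by
    have h1 : ‖exp ζ - 1 - ζ‖ ≤ ‖ζ‖ ^ 2 := Complex.norm_exp_sub_one_sub_id_le hζ1.le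
    have h2 : ‖ζ‖ ≤ ‖exp ζ - 1‖ + ‖exp ζ - 1 - ζ‖ := by
      have := norm_sub_le (exp ζ - 1) (exp ζ - 1 - ζ)
      rwa [sub_sub_cancel] at this
    have h3 : ‖ζ‖ ^ 2 ≤ ‖ζ‖ * (1 / 2) := by
      rw [pow_two]; exact mul_le_mul_of_nonneg_left hζ (norm_nonneg _)
    linarith
  have : ‖ζ‖ ≤ 2 * (C₁ / (2 * Real.pi * ((k : ℝ) + 1))) := by linarith
  calc ‖ζ‖ ≤ 2 * (C₁ / (2 * Real.pi * ((k : ℝ) + 1))) := this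
    _ = C₁ / (Real.pi * ((k : ℝ) + 1)) := by
        have hπ := Real.pi_pos.ne'
        field_simp

/-- Norm bounds for a point `(k+1) ω e^{ζ/d}` on the local ray, `‖ζ‖ ≤ 1/2`, `d ≥ 1`:
`(k+1)‖ω‖/3 ≤ ‖z₀‖ ≤ 3 (k+1)‖ω‖`. -/
theorem norm_ray_point_bounds (ω : ℂ) {d : ℕ} (hd1 : 1 ≤ d) (k : ℕ) {ζ : ℂ} (hζ : ‖ζ‖ ≤ 1 / 2) :
    ‖((k : ℂ) + 1) * ω * exp (ζ / d)‖ ≤ 3 * (((k : ℝ) + 1) * ‖ω‖) ∧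
      ((k : ℝ) + 1) * ‖ω‖ / 3 ≤ ‖((k : ℂ) + 1) * ω * exp (ζ / d)‖ := by
  have hx1 : ‖ζ / (d : ℂ)‖ ≤ 1 := by
    rw [norm_div, Complex.norm_natCast]
    exact (div_le_self (norm_nonneg _) (by exact_mod_cast hd1)).trans (hζ.trans (by norm_num))
  have hk0 : (0 : ℝ) ≤ (k : ℝ) := Nat.cast_nonneg k
  rw [norm_mul, norm_mul, norm_natCast_add_one]
  constructor
  · calc ((k : ℝ) + 1) * ‖ω‖ * ‖exp (ζ / d)‖ ≤ ((k : ℝ) + 1) * ‖ω‖ * 3 :=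
        mul_le_mul_of_nonneg_left (norm_exp_le_three hx1) (by positivity)
      _ = 3 * (((k : ℝ) + 1) * ‖ω‖) := by ring
  · calc ((k : ℝ) + 1) * ‖ω‖ / 3 = ((k : ℝ) + 1) * ‖ω‖ * (1 / 3) := by ring
      _ ≤ ((k : ℝ) + 1) * ‖ω‖ * ‖exp (ζ / d)‖ :=
          mul_le_mul_of_nonneg_left (third_le_norm_exp hx1) (by positivity)

/-! ## Part B. A second polynomial near the ray -/

/-- **Real part of `G` on the unit disc around a ray point.**  `G` of degree `m ≥ 1` with leading
coefficient `b`; `d ≥ 1`; `‖ζ‖ ≤ 1/2`, `‖ζ‖ ≤ K₁/(k+1)`, `m ‖ζ‖ ≤ 1`; `‖z - (k+1) ω e^{ζ/d}‖ ≤ 1`.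
Then `Re G(z) ≤ Re(b ω^m) (k+1)^m + K₂ (k+1)^{m-1}` with
`K₂ = 2 m K₁ ‖b‖ ‖ω‖^m + (m ‖b‖ + Σ‖(G.eraseLead)ᵢ‖) (3‖ω‖+1)^{m-1}`. (new) -/
theorem re_eval_near_ray_le (G : Polynomial ℂ) (hm : 1 ≤ G.natDegree) (ω : ℂ) {d : ℕ}
    (hd1 : 1 ≤ d) {K₁ : ℝ} (k : ℕ) {ζ : ℂ} (hζ : ‖ζ‖ ≤ 1 / 2)
    (hζK : ‖ζ‖ ≤ K₁ / ((k : ℝ) + 1)) (hζm : (G.natDegree : ℝ) * ‖ζ‖ ≤ 1) {z : ℂ}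
    (hz : ‖z - ((k : ℂ) + 1) * ω * exp (ζ / d)‖ ≤ 1) :
    (G.eval z).re ≤ (G.leadingCoeff * ω ^ G.natDegree).re * ((k : ℝ) + 1) ^ G.natDegree +
      (2 * G.natDegree * K₁ * ‖G.leadingCoeff‖ * ‖ω‖ ^ G.natDegree +
        (G.natDegree * ‖G.leadingCoeff‖ + coeffNormSum G.eraseLead) *
          (3 * ‖ω‖ + 1) ^ (G.natDegree - 1)) * ((k : ℝ) + 1) ^ (G.natDegree - 1) := by
  -- opaque names
  obtain ⟨m, hm_def⟩ : ∃ m : ℕ, m = G.natDegree := ⟨_, rfl⟩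
  obtain ⟨b, hb_def⟩ : ∃ b : ℂ, b = G.leadingCoeff := ⟨_, rfl⟩
  obtain ⟨ℓ, hℓ_def⟩ : ∃ ℓ : Polynomial ℂ, ℓ = G.eraseLead := ⟨_, rfl⟩
  obtain ⟨kk, hkk_def⟩ : ∃ kk : ℝ, kk = (k : ℝ) + 1 := ⟨_, rfl⟩
  obtain ⟨z₀, hz₀_def⟩ : ∃ z₀ : ℂ, z₀ = ((k : ℂ) + 1) * ω * exp (ζ / d) := ⟨_, rfl⟩
  rw [← hm_def, ← hb_def, ← hℓ_def, ← hkk_def]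
  rw [← hz₀_def] at hz
  rw [← hm_def] at hζm
  rw [← hkk_def] at hζK
  have hk0 : (0 : ℝ) ≤ (k : ℝ) := Nat.cast_nonneg k
  have hkk1 : 1 ≤ kk := by rw [hkk_def]; linarith
  have hkkpos : 0 < kk := by linarith
  have hm1 : (1 : ℝ) ≤ m := by exact_mod_cast (hm_def ▸ hm)
  -- size of the points
  obtain ⟨hz₀up, -⟩ := norm_ray_point_bounds ω hd1 k hζ
  rw [← hz₀_def, ← hkk_def] at hz₀up
  set M : ℝ := kk * (3 * ‖ω‖ + 1) with hM
  have hM1 : 1 ≤ M := by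
    have h2 : (1 : ℝ) ≤ 3 * ‖ω‖ + 1 := by linarith [norm_nonneg ω]
    rw [hM]; nlinarith
  have hz₀M : ‖z₀‖ ≤ M := by rw [hM]; nlinarith [norm_nonneg ω]
  have hzM : ‖z‖ ≤ M := by
    have h1 := norm_le_insert' z z₀
    rw [hM]; nlinarith [norm_nonneg ω]
  have hMpow : M ^ (m - 1) = (3 * ‖ω‖ + 1) ^ (m - 1) * kk ^ (m - 1) := by
    rw [hM, mul_pow]; ring
  -- decomposition `G(z) = b z₀^m + b (z^m - z₀^m) + ℓ(z)`
  have hG : G.eval z = b * z₀ ^ m + b * (z ^ m - z₀ ^ m) + ℓ.eval z := by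
    rw [eval_eq_eraseLead_add G z, ← hℓ_def, ← hb_def, ← hm_def]; ring
  -- (1) the leading term on the ray
  have hdC : (d : ℂ) ≠ 0 := Nat.cast_ne_zero.mpr (by omega)
  have hz₀pow : z₀ ^ m = (kk : ℂ) ^ m * ω ^ m * exp ((m : ℂ) * (ζ / d)) := by
    rw [hz₀_def, mul_pow, mul_pow, ← Complex.exp_nat_mul, hkk_def]
    push_cast; ring
  set w : ℂ := (m : ℂ) * (ζ / d) with hw
  have hwnorm : ‖w‖ ≤ (m : ℝ) * ‖ζ‖ := by
    rw [hw, norm_mul, Complex.norm_natCast, norm_div, Complex.norm_natCast]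
    refine mul_le_mul_of_nonneg_left ?_ (Nat.cast_nonneg m)
    exact div_le_self (norm_nonneg _) (by exact_mod_cast hd1)
  have hw1 : ‖w‖ ≤ 1 := hwnorm.trans hζm
  have hwK : ‖w‖ ≤ (m : ℝ) * (K₁ / kk) := hwnorm.trans (mul_le_mul_of_nonneg_left hζK (Nat.cast_nonneg m))
  have h1 : (b * z₀ ^ m).re ≤ (b * ω ^ m).re * kk ^ m + 2 * m * K₁ * ‖b‖ * ‖ω‖ ^ m * kk ^ (m - 1) := by
    have e1 : b * z₀ ^ m = ((kk ^ m : ℝ) : ℂ) * (b * ω ^ m) + ((kk ^ m : ℝ) : ℂ) * (b * ω ^ m * (exp w - 1)) := by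
      rw [hz₀pow]; push_cast; ring
    rw [e1, Complex.add_re, Complex.re_ofReal_mul, Complex.re_ofReal_mul]
    have h2 : (b * ω ^ m * (exp w - 1)).re ≤ ‖b‖ * ‖ω‖ ^ m * (2 * ‖w‖) := by
      refine (re_le_norm _).trans ?_
      rw [norm_mul, norm_mul, norm_pow]
      exact mul_le_mul_of_nonneg_left (Complex.norm_exp_sub_one_le hw1) (by positivity)
    have hkkm : kk ^ m = kk * kk ^ (m - 1) := by
      rw [← pow_succ', Nat.sub_add_cancel (hm_def ▸ hm)]
    have h3 : kk ^ m * (b * ω ^ m * (exp w - 1)).re ≤ 2 * m * K₁ * ‖b‖ * ‖ω‖ ^ m * kk ^ (m - 1) := by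
      calc kk ^ m * (b * ω ^ m * (exp w - 1)).re ≤ kk ^ m * (‖b‖ * ‖ω‖ ^ m * (2 * ‖w‖)) :=
            mul_le_mul_of_nonneg_left h2 (by positivity)
        _ ≤ kk ^ m * (‖b‖ * ‖ω‖ ^ m * (2 * ((m : ℝ) * (K₁ / kk)))) := by
            refine mul_le_mul_of_nonneg_left ?_ (by positivity)
            refine mul_le_mul_of_nonneg_left ?_ (by positivity)
            linarith
        _ = 2 * m * K₁ * ‖b‖ * ‖ω‖ ^ m * kk ^ (m - 1) := by
            rw [hkkm]; field_simp
    nlinarith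
  -- (2) the variation of the leading monomial
  have h2 : (b * (z ^ m - z₀ ^ m)).re ≤ m * ‖b‖ * (3 * ‖ω‖ + 1) ^ (m - 1) * kk ^ (m - 1) := by
    refine (re_le_norm _).trans ?_
    rw [norm_mul]
    have h3 := norm_pow_sub_pow_le hzM hz₀M m
    calc ‖b‖ * ‖z ^ m - z₀ ^ m‖ ≤ ‖b‖ * (m * M ^ (m - 1) * ‖z - z₀‖) :=
          mul_le_mul_of_nonneg_left h3 (norm_nonneg _)
      _ ≤ ‖b‖ * (m * M ^ (m - 1) * 1) := by
          refine mul_le_mul_of_nonneg_left (mul_le_mul_of_nonneg_left hz (by positivity)) (norm_nonneg _)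
      _ = m * ‖b‖ * (3 * ‖ω‖ + 1) ^ (m - 1) * kk ^ (m - 1) := by rw [hMpow]; ring
  -- (3) the lower-order part
  have h3 : (ℓ.eval z).re ≤ coeffNormSum ℓ * (3 * ‖ω‖ + 1) ^ (m - 1) * kk ^ (m - 1) := by
    refine (re_le_norm _).trans ?_
    have hℓdeg : ℓ.natDegree ≤ m - 1 := by
      rw [hℓ_def, hm_def]; exact Polynomial.eraseLead_natDegree_le G
    have := norm_eval_le_of_natDegree_le ℓ hM1 hzM hℓdeg
    rw [hMpow] at this
    linarith
  rw [hG, Complex.add_re, Complex.add_re]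
  nlinarith

/-- **Norm of `G` on the unit disc around a ray point**: `‖G(z)‖ ≤ Σ‖Gᵢ‖ (3‖ω‖+1)^m (k+1)^m`.
(new) -/
theorem norm_eval_near_ray_le (G : Polynomial ℂ) (ω : ℂ) {d : ℕ} (hd1 : 1 ≤ d) (k : ℕ) {ζ : ℂ}
    (hζ : ‖ζ‖ ≤ 1 / 2) {z : ℂ} (hz : ‖z - ((k : ℂ) + 1) * ω * exp (ζ / d)‖ ≤ 1) :
    ‖G.eval z‖ ≤ coeffNormSum G * (3 * ‖ω‖ + 1) ^ G.natDegree * ((k : ℝ) + 1) ^ G.natDegree := by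
  obtain ⟨hz₀up, -⟩ := norm_ray_point_bounds ω hd1 k hζ
  have hk0 : (0 : ℝ) ≤ (k : ℝ) := Nat.cast_nonneg k
  set M : ℝ := ((k : ℝ) + 1) * (3 * ‖ω‖ + 1) with hM
  have hM1 : 1 ≤ M := by
    have h1 : (1 : ℝ) ≤ (k : ℝ) + 1 := by linarith
    have h2 : (1 : ℝ) ≤ 3 * ‖ω‖ + 1 := by linarith [norm_nonneg ω]
    rw [hM]; nlinarith
  have hzM : ‖z‖ ≤ M := by
    have h1 := norm_le_insert' z (((k : ℂ) + 1) * ω * exp (ζ / d))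
    rw [hM]; nlinarith [norm_nonneg ω]
  have := norm_eval_le_of_natDegree_le G hM1 hzM le_rfl
  rw [hM, mul_pow] at this
  linarith

end Summit.Schanuel.Schanuel.Theorems
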